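import Literature.Probability.LatticeModels.MedialInterface
import Literature.Probability.Percolation.Percolation
import HarnessLib

/-!
# Sketch — crux-ideate stmt-CriticalPhenomena-10814 (ParafermionFamiliesToSLESix), ideator 3

First checkable statements of the line `six-arm-collar-compensator` (idea card
`idea-six-arm-collar-compensator.md`).  Nothing here is proved; the point is that the
statements elaborate over existing declarations.

* `LeftChainToArcA` — the combinatorial heart of the SIX-ARM COLLAR LEMMA: along the medial
  exploration path every primal vertex on the LEFT of a step is joined to the wired arc `A` by
  `bcBondConfig`-open edges (the docstring of `IsMedialExploration` asserts this "by induction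
  along the turning rule"; it is not a theorem of the tree).  Consequence used by the card: in
  the slit domain `Ω ∖ γ[0,t]` the left side of the slit is an OPEN-CONNECTED CHAIN inside the
  cluster of `A`, so a distinct open cluster approaching it from the accessible side within
  distance `ε` forces six alternating arms (closed dual side of `γ`, open chain-before, closed
  separator, open intruder, closed separator, open chain-after) from an `ε`-box to macroscopic
  distance.
* `LeftChainStep` — consecutive left vertices are equal or joined by an open edge (the chain is
  connected through the path itself).
* `touchCompensator` — the discrete anchor: the expected number of free-arc-adjacent sites of a
  fixed boundary window touched by the interface, written as a sum of one-arm probabilities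
  (arc-`B` sites themselves are frozen out in the H21 rendering, so the anchor sites are the
  inner corners of `B`-adjacent faces); typed here only as the unconditional (`t = 0`)
  functional of a discrete Dobrushin datum, which is all the fixed-domain identification step
  (S1) talks about; its conditional versions in slit domains are the martingales of stub N4.
-/

namespace Summit.CriticalPhenomena.CardyFormulaZ2.Cruxes.ParafermionFamiliesToSLESix.Sketch

open Literature.Probability.LatticeModels Literature.Probability.Percolation
open MeasureTheory

/-- LEFT CHAIN (first lemma of the six-arm collar lemma): for every exploration path `γ` of `ω`
in `D`, the primal vertex `v` of every step `(e, e')` of `γ` (the corner `(v, f)` carrying the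
medial dart, `v` on the left) is joined to a site of the discrete arc `A` by edges that are open
in the boundary-condition-completed configuration `D.bcBondConfig ω` (a site of the arc counts,
by reflexivity of `Reachable`). Provable now by induction along `IsMedialExploration.turn`
starting from `IsMedialExploration.start`. -/
def LeftChainToArcA : Prop :=
  ∀ (D : DiscreteDobrushin) (ω : BondConfig (Site 2)) (γ : List MedialVertex),
    IsMedialExploration D ω γ →
    ∀ (e e' : MedialVertex), [e, e'] <:+: γ →
    ∀ (v f : Site 2), IsCorner v f → cornerSource v f = e → cornerTarget v f = e' →
      ∃ x ∈ D.zdArcA, (openGraph (D.bcBondConfig ω)).Reachable v x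

/-- LEFT CHAIN, local step: two consecutive steps of an exploration path have the same left
vertex (the path turns around it, crossing a closed edge) or left vertices joined by the open
edge the path follows (turning inside the common face). This is `IsMedialTurn` read on the
primal side; with `LeftChainToArcA` it says the left side of `γ[0,t]` is an open-connected chain
in the cluster of the wired arc. -/
def LeftChainStep : Prop :=
  ∀ (D : DiscreteDobrushin) (ω : BondConfig (Site 2)) (γ : List MedialVertex),
    IsMedialExploration D ω γ →
    ∀ (e₀ e₁ e₂ : MedialVertex), [e₀, e₁, e₂] <:+: γ →
    ∀ (v₁ f₁ v₂ f₂ : Site 2), IsCorner v₁ f₁ → cornerSource v₁ f₁ = e₀ → cornerTarget v₁ f₁ = e₁ →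
      IsCorner v₂ f₂ → cornerSource v₂ f₂ = e₁ → cornerTarget v₂ f₂ = e₂ →
      v₁ = v₂ ∨ (s(v₁, v₂) ∈ D.bcBondConfig ω ∧ s(v₁, v₂) = e₁)

/-- The discrete TOUCH COMPENSATOR at time `0` for a discrete Dobrushin datum `E` and a window
`I ⊆ ℂ` of the plane: the expected number of *free-arc-adjacent* sites in `I` touched by the
exploration interface. In the H21 rendering the sites of the arc `B` are frozen out (every edge
at a `zdArcB` site is closed in `bcBondConfig`), so "the interface touches the free arc at `w`"
is attached to the sites `w ∉ zdArcB` that are corners of an inner face having a corner on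
`zdArcB`; for such `w` the interface traverses the corner `(w, f)` iff `w` is joined to the arc
`A` by `bcBondConfig`-open edges (card terminal-anchor-ratio-martingale's
`BoundaryPassageIffConnectedToA`, twin crux 11389), so the compensator is a sum of one-arm
probabilities `P_{1/2}(w ↔ A)`. Normalised by `δ^{2/3}` (= `δ^{-1/3}` per site times the site
spacing `δ`) it is the quantity whose scaling limit the line identifies as
`c ∫_I |Φ'_E|^{1/3} |dv|` (stub S1) and whose conditional versions in slit domains are the
martingale anchors (stub N4). -/
noncomputable def touchCompensator (E : DiscreteDobrushin) (I : Set ℂ) : ℝ :=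
  ∑ᶠ w : Site 2, Set.indicator
    {w : Site 2 | w ∉ E.zdArcB ∧
      (∃ f : Site 2, E.IsInnerFace f ∧ IsCorner w f ∧ ∃ u : Site 2, IsCorner u f ∧ u ∈ E.zdArcB) ∧
      ((E.δ : ℂ) * ((w 0 : ℝ) + (w 1 : ℝ) * Complex.I)) ∈ I}
    (fun w => (bondPercolation (zdGraph 2) half).real
      {ω | ∃ x ∈ E.zdArcA, (openGraph (E.bcBondConfig ω)).Reachable w x}) w

/-- Shape of the fixed-domain TOUCHING-INTENSITY LAW (output of stub S1, input of the phase-free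
half of the line), for one Dobrushin domain `D`, one family `Λ` and one boundary window `I`:
the normalised touch compensator converges to a limit `m`.  (The line identifies
`m = c ∫_{I ∩ ∂D} |Φ'_D|^{1/3} |dv|`; the conformal integral is not typed here.) -/
def HasTouchIntensityLimit (Λ : ℝ → DiscreteDobrushin) (I : Set ℂ) (m : ℝ) : Prop :=
  Filter.Tendsto (fun δ : ℝ => δ ^ ((2 : ℝ) / 3) * touchCompensator (Λ δ) I)
    (nhdsWithin 0 (Set.Ioi 0)) (nhds m)

end Summit.CriticalPhenomena.CardyFormulaZ2.Cruxes.ParafermionFamiliesToSLESix.Sketch
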